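import Mathlib
import Literature.NumberTheory.Transcendental.LinEDS
import Literature.NumberTheory.Transcendental.LinEDSCode
import Literature.NumberTheory.Transcendental.MZVWordShuffle
import HarnessLib

/-!
# `KernelModuloPeriodConjecture`, line `Sketch`, E1: `LinEDS.shBits` is `MZV.shuffleWord` mod 2

Crux `FurushoPentagon.KernelModuloPeriodConjecture` (stmt-KontsevichZagierPeriods-15058), line
`Sketch`; soundness chain of the kernel-checkable `𝔽₂` rank engine `LinEDS` for the linearised
extended double shuffle system [IharaKanekoZagier2006, §2], first link (E1, "shuffle parity"):
bit `i` of the bitset shuffle product `LinEDS.shBits u v` (sets of words of length `|u| + |v|`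
packed into one natural number, bit position `LinEDS.code w`, multiplicities mod 2) is the parity
of the number of interleavings `w ∈ u ш v` (`MZV.shuffleWord u v`, listed with multiplicity) with
`code w = i` (`stub_shBits_testBit`).

The proof is the simultaneous induction behind the two recursions
`shBits (a u) (b v) = pre a m (shBits u (b v)) ^^^ pre b m (shBits (a u) v)` (`m = |u| + |v| + 1`)
and `(a u) ш (b v) = a (u ш b v) ++ b ((a u) ш v)` (`MZV.shuffleWord_cons_cons`): the `xor` of
two bits is the parity of a sum (`Nat.bodd_add`, `Nat.testBit_xor`), and prepending a letter `a`
to a set of words of length `m` is `pre a m` on codes (`LinEDS.testBit_pre`, `LinEDS.code_cons`: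
`y` adds `2^m`, `x` adds nothing). Everything here is elementary. [folklore]
-/

namespace Summit.KontsevichZagierPeriods.FurushoPentagon.KernelModuloPeriodConjecture

open Literature.NumberTheory.Transcendental

/-- `Nat.bodd n = true ↔ n` is odd. [folklore] -/
theorem shBitsE1_bodd_eq_true_iff (n : ℕ) : n.bodd = true ↔ Odd n := by
  rw [Nat.odd_iff, Nat.mod_two_of_bodd]
  cases n.bodd <;> simp

/-- Prepending a letter, read through codes mod 2, is `LinEDS.pre`: if bit `i` of `S` is the
parity of `#{w ∈ L : code w = i}` for every `i`, `L` a list of words of length `m`, then bit `i`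
of `pre a m S` is the parity of `#{w ∈ L : code (a w) = i}`. [folklore] -/
theorem shBitsE1_testBit_pre {L : List (List Bool)} {m : ℕ} (hL : ∀ w ∈ L, w.length = m)
    (a : Bool) {S : ℕ}
    (hS : ∀ i, S.testBit i = Nat.bodd (L.countP fun w => decide (LinEDS.code w = i))) (i : ℕ) :
    (LinEDS.pre a m S).testBit i =
      Nat.bodd ((L.map (List.cons a)).countP fun w => decide (LinEDS.code w = i)) := by
  rw [LinEDS.testBit_pre, List.countP_map]
  cases a with
  | false =>
    rw [if_neg Bool.false_ne_true, hS i]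
    congr 1
    exact List.countP_congr fun w _ => by simp [LinEDS.code_cons]
  | true =>
    rw [if_pos rfl]
    by_cases hi : 2 ^ m ≤ i
    · rw [decide_eq_true hi, Bool.true_and, hS (i - 2 ^ m)]
      congr 1
      exact List.countP_congr fun w hw => by
        simp only [Function.comp_apply, decide_eq_true_iff, LinEDS.code_cons, hL w hw,
          Bool.toNat_true, one_mul]
        omega
    · rw [decide_eq_false hi, Bool.false_and,
        List.countP_eq_zero.2 fun w hw => by
          simp only [Function.comp_apply, decide_eq_true_iff, LinEDS.code_cons, hL w hw,
            Bool.toNat_true, one_mul]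
          omega]
      rfl

/-- **Shuffle parity, `Bool`-valued form.** Bit `i` of `shBits u v` is the parity (`Nat.bodd`) of
the number of `w ∈ u ш v` (with multiplicity) with `code w = i`. [folklore] -/
theorem shBitsE1_testBit_eq_bodd : ∀ (u v : List Bool) (i : ℕ),
    (LinEDS.shBits u v).testBit i =
      Nat.bodd ((MZV.shuffleWord u v).countP fun w => decide (LinEDS.code w = i))
  | [], v, i => by
    rw [show LinEDS.shBits [] v = 2 ^ LinEDS.code v from rfl, MZV.shuffleWord_nil_left,
      List.countP_singleton, Nat.testBit_two_pow]
    by_cases h : LinEDS.code v = i <;> simp [h]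
  | a :: u, [], i => by
    rw [show LinEDS.shBits (a :: u) [] = 2 ^ LinEDS.code (a :: u) from rfl,
      MZV.shuffleWord_nil_right, List.countP_singleton, Nat.testBit_two_pow]
    by_cases h : LinEDS.code (a :: u) = i <;> simp [h]
  | a :: u, b :: v, i => by
    have hL₁ : ∀ w ∈ MZV.shuffleWord u (b :: v), w.length = u.length + v.length + 1 :=
      fun w hw => by
        have := MZV.length_of_mem_shuffleWord u (b :: v) hw
        simp only [List.length_cons] at this
        omega
    have hL₂ : ∀ w ∈ MZV.shuffleWord (a :: u) v, w.length = u.length + v.length + 1 :=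
      fun w hw => by
        have := MZV.length_of_mem_shuffleWord (a :: u) v hw
        simp only [List.length_cons] at this
        omega
    rw [show LinEDS.shBits (a :: u) (b :: v) =
        LinEDS.pre a (u.length + v.length + 1) (LinEDS.shBits u (b :: v)) ^^^
          LinEDS.pre b (u.length + v.length + 1) (LinEDS.shBits (a :: u) v) from rfl,
      MZV.shuffleWord_cons_cons, List.countP_append, Nat.bodd_add, Nat.testBit_xor,
      shBitsE1_testBit_pre hL₁ a (shBitsE1_testBit_eq_bodd u (b :: v)),
      shBitsE1_testBit_pre hL₂ b (shBitsE1_testBit_eq_bodd (a :: u) v)]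

/-- **E1 — shuffle parity.** Bit `i` of the bitset shuffle `shBits u v` is the parity of the
number of interleavings `w ∈ u ш v` (`MZV.shuffleWord`, with multiplicity) with `code w = i`:
the bitset shuffle product of the `𝔽₂` rank engine `LinEDS` agrees with the shuffle product of
words of [IharaKanekoZagier2006, §2] reduced mod 2. [folklore] -/
theorem stub_shBits_testBit :
    ∀ (u v : List Bool) (i : ℕ), (LinEDS.shBits u v).testBit i = true ↔
      Odd ((MZV.shuffleWord u v).countP fun w => decide (LinEDS.code w = i)) := fun u v i => by
  rw [shBitsE1_testBit_eq_bodd, shBitsE1_bodd_eq_true_iff]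

end Summit.KontsevichZagierPeriods.FurushoPentagon.KernelModuloPeriodConjecture
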